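import Literature.Analysis.FluidPDE.QuasiSelfSimilarTimeGluing
import Literature.Analysis.FluidPDE.PassiveScalarClassicalEnergy
import Literature.Analysis.FunctionSpaces.TorusEnstrophyOrthogonality
import HarnessLib

/-!
# Cheskidov's time-glued family, I: the glued drifts and inviscid profiles
(arXiv:2311.04182, §3, (3.4)–(3.8); Bruè–De Lellis 2023, §5, (5.1)–(5.4))

Topic `Literature/Analysis/FluidPDE` (support file for the proof of
`Literature.Analysis.FluidPDE.cheskidov_total_dissipation_family`). From a sequence of *building
blocks* — smooth solutions `ρ_n` of the transport equation with smooth divergence-free drifts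
`v_n` on the unit time interval, handed over continuously, `ρ_n(1) = ρ_{n+1}(0)` (Cheskidov 2023,
Thm. 3.1 (d); Bruè–De Lellis 2023, Thm. 4.1 (d)) — Cheskidov (3.4)–(3.5) glues the rescaled
blocks in time: block `n` is played on the `n`-th gluing interval `[t_n, t_{n+1})` through a
smooth nondecreasing reparametrisation `η` which is flat at the gluing times. This file performs
the gluing with the accepted bookkeeping of `QuasiSelfSimilarTimeGluing` (`Gluing.tn`,
`Gluing.tau`, `Gluing.sigma`: `σ_n = 0` on `[t_n, t_n + τ_n/3]`, `= 1` on `[t_n + 2τ_n/3, ∞)`),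
in a form in which every field is a **finite sum of globally smooth space–time fields**:

* `Gluing.blockDrift v n (t, x) = σ_n'(t) v_n(σ_n(t), x)` and
  `Gluing.blockProfile ρ n (t, x) = ρ_n(σ_n(t), x)` — block `n` reparametrised; the drift
  vanishes off `(t_n, t_{n+1})`, the profile is frozen at `ρ_n(0)` before and at `ρ_n(1)` after
  the block; both are smooth on `ℝ × T^d` and solve the transport equation on all of `ℝ`
  (chain rule; Cheskidov 2023, (3.4)–(3.5) block by block);
* `Gluing.drift v m = ∑_{n ≤ m} blockDrift v n` — Cheskidov's `ṽ^m` of (3.4) extended by zero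
  (`v^m` of §4), and `Gluing.profile ρ m = ρ_0(0) + ∑_{n ≤ m} (blockProfile ρ n - ρ_n(0))` —
  Cheskidov's `ρ̃^m` of (3.5) / `ρ^m` of §4 (telescoping thanks to the handover: on
  `[t_j, t_{j+1}]`, `j ≤ m`, it *is* block `j`, `Gluing.profile_eq_blockProfile`; after
  `t_{m+1}` it is frozen at `ρ_m(1)`);
* the structural facts used in §4 and §6 of the source: smoothness on `ℝ × T^d`, the transport
  equation `∂ₜρ^m + v^m·∇ρ^m = 0` on every time set (`Gluing.isClassicalScalarTransportOn_profile`),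
  `v^m = 0` off `(0, 1)` and on `[t_{m+1}, ∞)`, eventual stationarity of `m ↦ v^m` on `[0, T]`,
  `T < 1`, and of `m ↦ ρ^m`, `ρ^m(0) = ρ_0(0)`.

Design note: the source's `η` satisfies `η(t_n) = t_n`, `η^{(k)}(t_n) = 0`; the accepted
`Gluing.sigma` is moreover *locally constant* near the gluing times, which makes the glued
fields finite sums of smooth fields and all junction smoothness trivial — the resulting family
has exactly the properties (3.6)–(3.8) and §4 use. The limit objects `ṽ`, `ρ̃` of (3.7)–(3.8)
and the estimates are in the sequel files.

## References

* A. Cheskidov, *Dissipation anomaly and anomalous dissipation in incompressible fluid flows*,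
  arXiv:2311.04182 (2023), §3, (3.4)–(3.8), §4 (the fields `v^m`, `ρ^m`).
* E. Bruè, C. De Lellis, *Anomalous dissipation for the forced 3D Navier–Stokes equations*,
  Comm. Math. Phys. 400 (2023), §5, (5.1)–(5.4).
-/

noncomputable section

open MeasureTheory Set Filter
open _root_.Topology
open scoped InnerProductSpace ContDiff

namespace Literature.Analysis.FluidPDE.Gluing

variable {d : Type*} [Fintype d] [DecidableEq d]

/-! ## The reparametrised blocks -/

/-- **Block drift** `blockDrift v n (t, x) = σ_n'(t) • v_n(σ_n(t), x)`: the `n`-th building-block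
velocity played on the `n`-th gluing interval (Cheskidov 2023, (3.4): the summand
`η'(t) χ_{[t_n,t_{n+1})}(η(t)) τ_n⁻¹ v_n(x, (η(t)-t_n)/τ_n)`, with `σ_n = (η - t_n)/τ_n` on the
block). [cite: Cheskidov2023, §3 (3.4)] -/
def blockDrift (v : ℕ → ℝ → UnitAddTorus d → EuclideanSpace ℝ d) (n : ℕ) (t : ℝ)
    (x : UnitAddTorus d) : EuclideanSpace ℝ d :=
  deriv (sigma n) t • v n (sigma n t) x

/-- **Block profile** `blockProfile ρ n (t, x) = ρ_n(σ_n(t), x)`: the `n`-th building-block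
scalar played on the `n`-th gluing interval (Cheskidov 2023, (3.5): the summand
`χ_{[t_n,t_{n+1})}(η(t)) ρ_n(x, (η(t)-t_n)/τ_n)`). [cite: Cheskidov2023, §3 (3.5)] -/
def blockProfile (ρ : ℕ → ℝ → UnitAddTorus d → ℝ) (n : ℕ) (t : ℝ) (x : UnitAddTorus d) : ℝ :=
  ρ n (sigma n t) x

section Blocks

variable {v : ℕ → ℝ → UnitAddTorus d → EuclideanSpace ℝ d} {ρ : ℕ → ℝ → UnitAddTorus d → ℝ}
  {n : ℕ} {t : ℝ}

omit [Fintype d] [DecidableEq d] in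
/-- The block drift vanishes up to the gluing time `t_n` (indeed up to `t_n + τ_n/3`). [folklore] -/
theorem blockDrift_eq_zero_of_le (v : ℕ → ℝ → UnitAddTorus d → EuclideanSpace ℝ d)
    (ht : t ≤ tn n) : blockDrift v n t = 0 := by
  funext x
  rw [blockDrift, deriv_sigma_of_lt (by linarith [tau_pos n]), zero_smul]
  rfl

omit [Fintype d] [DecidableEq d] in
/-- The block drift vanishes from the gluing time `t_{n+1}` on (indeed from `t_n + 2τ_n/3`). [folklore] -/
theorem blockDrift_eq_zero_of_ge (v : ℕ → ℝ → UnitAddTorus d → EuclideanSpace ℝ d)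
    (ht : tn (n + 1) ≤ t) : blockDrift v n t = 0 := by
  funext x
  rw [blockDrift, deriv_sigma_of_gt (by rw [tn_succ] at ht; linarith [tau_pos n]), zero_smul]
  rfl

omit [Fintype d] [DecidableEq d] in
/-- The block drift is supported in the open gluing interval `(t_n, t_{n+1})`. [folklore] -/
theorem blockDrift_eq_zero_of_not_mem (v : ℕ → ℝ → UnitAddTorus d → EuclideanSpace ℝ d)
    (ht : t ∉ Ioo (tn n) (tn (n + 1))) : blockDrift v n t = 0 := by
  rw [mem_Ioo, not_and_or, not_lt, not_lt] at ht
  rcases ht with ht | ht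
  · exact blockDrift_eq_zero_of_le v ht
  · exact blockDrift_eq_zero_of_ge v ht

omit [Fintype d] [DecidableEq d] in
/-- Before the block (up to `t_n`) the profile is frozen at `ρ_n(0)`. [folklore] -/
theorem blockProfile_eq_of_le (ρ : ℕ → ℝ → UnitAddTorus d → ℝ) (ht : t ≤ tn n) :
    blockProfile ρ n t = ρ n 0 := by
  funext x
  rw [blockProfile, sigma_of_le (by linarith [tau_pos n])]

omit [Fintype d] [DecidableEq d] in
/-- After the block (from `t_{n+1}` on) the profile is frozen at `ρ_n(1)`. [folklore] -/
theorem blockProfile_eq_of_ge (ρ : ℕ → ℝ → UnitAddTorus d → ℝ) (ht : tn (n + 1) ≤ t) :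
    blockProfile ρ n t = ρ n 1 := by
  funext x
  rw [blockProfile, sigma_of_ge (by rw [tn_succ] at ht; linarith [tau_pos n])]

omit [DecidableEq d] in
/-- The reparametrised block profile is smooth on all of `ℝ × T^d` when the block is jointly
smooth on `[0,1] × T^d` (composition with the smooth `σ_n : ℝ → [0,1]`). [folklore] -/
theorem isSmoothSpaceTimeOn_blockProfile (h : FunctionSpaces.Torus.IsSmoothSpaceTimeOn (Icc 0 1) (ρ n)) :
    FunctionSpaces.Torus.IsSmoothSpaceTimeOn univ (blockProfile ρ n) := by
  have hmap : ContDiff ℝ ∞ (fun p : ℝ × EuclideanSpace ℝ d => (sigma n p.1, p.2)) :=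
    ((sigma_contDiff n).comp contDiff_fst).prodMk contDiff_snd
  have hcomp := h.comp_contDiff hmap fun p => mk_mem_prod (sigma_mem_Icc n p.1) (mem_univ _)
  have heq : FunctionSpaces.Torus.stLift (blockProfile ρ n) =
      FunctionSpaces.Torus.stLift (ρ n) ∘ fun p : ℝ × EuclideanSpace ℝ d => (sigma n p.1, p.2) := by
    funext p; rfl
  unfold FunctionSpaces.Torus.IsSmoothSpaceTimeOn
  rw [heq]
  exact hcomp.contDiffOn

omit [DecidableEq d] in
/-- The reparametrised block drift is smooth on all of `ℝ × T^d` when the block is jointly smooth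
on `[0,1] × T^d`. [folklore] -/
theorem isSmoothSpaceTimeOn_blockDrift (h : FunctionSpaces.Torus.IsSmoothSpaceTimeOn (Icc 0 1) (v n)) :
    FunctionSpaces.Torus.IsSmoothSpaceTimeOn univ (blockDrift v n) := by
  have hmap : ContDiff ℝ ∞ (fun p : ℝ × EuclideanSpace ℝ d => (sigma n p.1, p.2)) :=
    ((sigma_contDiff n).comp contDiff_fst).prodMk contDiff_snd
  have hcomp := h.comp_contDiff hmap fun p => mk_mem_prod (sigma_mem_Icc n p.1) (mem_univ _)
  have hder : ContDiff ℝ ∞ (fun p : ℝ × EuclideanSpace ℝ d => deriv (sigma n) p.1) :=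
    (deriv_sigma_contDiff n).comp contDiff_fst
  have heq : FunctionSpaces.Torus.stLift (blockDrift v n) = fun p : ℝ × EuclideanSpace ℝ d =>
      deriv (sigma n) p.1 • (FunctionSpaces.Torus.stLift (v n) ∘ fun p : ℝ × EuclideanSpace ℝ d => (sigma n p.1, p.2)) p := by
    funext p; rfl
  unfold FunctionSpaces.Torus.IsSmoothSpaceTimeOn
  rw [heq]
  exact (hder.smul hcomp).contDiffOn

omit [DecidableEq d] in
/-- Time slices of the block profile are smooth. [folklore] -/
theorem isSmooth_blockProfile (h : FunctionSpaces.Torus.IsSmoothSpaceTimeOn (Icc 0 1) (ρ n)) (t : ℝ) :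
    FunctionSpaces.Torus.IsSmooth (blockProfile ρ n t) :=
  (isSmoothSpaceTimeOn_blockProfile h).isSmooth_slice (mem_univ t)

omit [DecidableEq d] in
/-- Time slices of the block drift are smooth. [folklore] -/
theorem isSmooth_blockDrift (h : FunctionSpaces.Torus.IsSmoothSpaceTimeOn (Icc 0 1) (v n)) (t : ℝ) :
    FunctionSpaces.Torus.IsSmooth (blockDrift v n t) :=
  (isSmoothSpaceTimeOn_blockDrift h).isSmooth_slice (mem_univ t)

omit [DecidableEq d] in
/-- **Chain rule for the block profile**: `∂ₜ ρ_n(σ_n(t), x) = σ_n'(t) (∂ₛρ_n)(σ_n(t), x)`, with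
the one-sided derivative of the block within `[0,1]` (two-sided derivative in `t`). [folklore] -/
theorem hasDerivAt_blockProfile (h : FunctionSpaces.Torus.IsSmoothSpaceTimeOn (Icc 0 1) (ρ n)) (t : ℝ)
    (x : UnitAddTorus d) :
    HasDerivAt (fun s => blockProfile ρ n s x)
      (deriv (sigma n) t * FunctionSpaces.Torus.timeDerivWithin (Icc 0 1) (ρ n) (sigma n t) x) t := by
  have hg := h.hasDerivWithinAt_slice (sigma_mem_Icc n t) x
  have hσ : HasDerivAt (sigma n) (deriv (sigma n) t) t :=
    (hasDerivAt_sigma n t).congr_deriv (deriv_sigma n t).symm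
  have h1 := hg.scomp_hasDerivAt t hσ fun s => sigma_mem_Icc n s
  simpa [blockProfile, Function.comp_def] using h1

omit [DecidableEq d] in
/-- **Chain and product rule for the block drift**:
`∂ₜ(σ_n' v_n(σ_n)) = σ_n'' v_n(σ_n) + (σ_n')² (∂ₛv_n)(σ_n)` (two-sided in `t`). [folklore] -/
theorem hasDerivAt_blockDrift (h : FunctionSpaces.Torus.IsSmoothSpaceTimeOn (Icc 0 1) (v n)) (t : ℝ)
    (x : UnitAddTorus d) :
    HasDerivAt (fun s => blockDrift v n s x)
      (deriv (deriv (sigma n)) t • v n (sigma n t) x +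
        deriv (sigma n) t • (deriv (sigma n) t • FunctionSpaces.Torus.timeDerivWithin (Icc 0 1) (v n) (sigma n t) x)) t := by
  have hg := h.hasDerivWithinAt_slice (sigma_mem_Icc n t) x
  have hσ : HasDerivAt (sigma n) (deriv (sigma n) t) t :=
    (hasDerivAt_sigma n t).congr_deriv (deriv_sigma n t).symm
  have hin : HasDerivAt (fun s => v n (sigma n s) x)
      (deriv (sigma n) t • FunctionSpaces.Torus.timeDerivWithin (Icc 0 1) (v n) (sigma n t) x) t :=
    hg.scomp_hasDerivAt t hσ fun s => sigma_mem_Icc n s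
  have hσ' : HasDerivAt (deriv (sigma n)) (deriv (deriv (sigma n)) t) t :=
    ((deriv_sigma_contDiff n (m := 1)).differentiable (by simp)).differentiableAt.hasDerivAt
  have h2 : HasDerivAt (fun s => deriv (sigma n) s • v n (sigma n s) x)
      (deriv (sigma n) t • (deriv (sigma n) t • FunctionSpaces.Torus.timeDerivWithin (Icc 0 1) (v n) (sigma n t) x) +
        deriv (deriv (sigma n)) t • v n (sigma n t) x) t := hσ'.smul hin
  rw [add_comm] at h2
  exact h2

/-- **Each reparametrised block solves the transport equation on all of `ℝ`**:
`∂ₜ(blockProfile ρ n) + blockDrift v n · ∇(blockProfile ρ n) = 0` (chain rule and the block's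
transport equation at the inner time `σ_n(t) ∈ [0,1]`; where `σ_n' = 0` both terms vanish;
Cheskidov 2023, (3.4)–(3.5) and (3.9)). [cite: Cheskidov2023, §3 (3.4)–(3.5)] -/
theorem deriv_blockProfile_add_inner (hsol : Torus.IsClassicalScalarTransportOn (Icc 0 1) 0 (v n) (ρ n))
    (t : ℝ) (x : UnitAddTorus d) :
    deriv (fun s => blockProfile ρ n s x) t +
      ⟪blockDrift v n t x, FunctionSpaces.Torus.gradient (blockProfile ρ n t) x⟫_ℝ = 0 := by
  rw [(hasDerivAt_blockProfile hsol.smooth_scalar t x).deriv]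
  have htr := hsol.transport (sigma n t) (sigma_mem_Icc n t) x
  rw [zero_mul] at htr
  have hgrad : FunctionSpaces.Torus.gradient (blockProfile ρ n t) x = FunctionSpaces.Torus.gradient (ρ n (sigma n t)) x := rfl
  rw [hgrad, blockDrift, real_inner_smul_left]
  have : FunctionSpaces.Torus.timeDerivWithin (Icc 0 1) (ρ n) (sigma n t) x =
      -⟪v n (sigma n t) x, FunctionSpaces.Torus.gradient (ρ n (sigma n t)) x⟫_ℝ := by linarith
  rw [this]
  ring

/-- The block drift is divergence free at every time when the block drift is (on `[0,1]`). [folklore] -/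
theorem isDivFree_blockDrift (hsol : Torus.IsClassicalScalarTransportOn (Icc 0 1) 0 (v n) (ρ n)) (t : ℝ) :
    FunctionSpaces.Torus.IsDivFree (blockDrift v n t) := by
  intro x
  have hv1 : FunctionSpaces.Torus.IsContDiff 1 (v n (sigma n t)) :=
    (hsol.smooth_velocity.isSmooth_slice (sigma_mem_Icc n t)).isContDiff (by simp)
  have heq : blockDrift v n t = deriv (sigma n) t • v n (sigma n t) := rfl
  rw [heq, FunctionSpaces.Torus.divergence]
  have : ∀ i, FunctionSpaces.Torus.partialDeriv i (fun y => (deriv (sigma n) t • v n (sigma n t)) y i) x =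
      deriv (sigma n) t * FunctionSpaces.Torus.partialDeriv i (fun y => v n (sigma n t) y i) x := by
    intro i
    have h1 : FunctionSpaces.Torus.IsContDiff 1 (fun y => v n (sigma n t) y i) := by
      have := (hsol.smooth_velocity.isSmooth_slice (sigma_mem_Icc n t)).comp_clm (EuclideanSpace.proj (𝕜 := ℝ) i)
      exact this.isContDiff (by simp)
    have h2 : (fun y => (deriv (sigma n) t • v n (sigma n t)) y i) = deriv (sigma n) t • fun y => v n (sigma n t) y i := by
      funext y; simp
    rw [h2, FunctionSpaces.Torus.partialDeriv_const_smul h1]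
    rfl
  simp_rw [this, ← Finset.mul_sum]
  rw [show ∑ i, FunctionSpaces.Torus.partialDeriv i (fun y => v n (sigma n t) y i) x = 0 from hsol.divFree _ (sigma_mem_Icc n t) x,
    mul_zero]

end Blocks

/-! ## The glued families `v^m`, `ρ^m` (Cheskidov 2023, (3.4)–(3.5), §4) -/

/-- **Cheskidov's glued drift** `v^m = ∑_{n ≤ m} blockDrift v n` (arXiv:2311.04182, (3.4),
extended by zero outside `[0,1)` as in §4: `v^m(t) = ṽ^m(t)` for `t < 1`, `0` for `t ≥ 1`). [cite: Cheskidov2023, §3 (3.4)] -/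
def drift (v : ℕ → ℝ → UnitAddTorus d → EuclideanSpace ℝ d) (m : ℕ) (t : ℝ) (x : UnitAddTorus d) :
    EuclideanSpace ℝ d :=
  ∑ n ∈ Finset.range (m + 1), blockDrift v n t x

/-- **Cheskidov's glued inviscid profile** `ρ^m = ρ_0(0) + ∑_{n ≤ m} (blockProfile ρ n - ρ_n(0))`
(arXiv:2311.04182, (3.5) and §4: on `[t_j, t_{j+1}]`, `j ≤ m`, this is block `j`, and it is
frozen at `ρ_m(1)` after `t_{m+1}`, `Gluing.profile_eq_blockProfile`, `Gluing.profile_eq_of_ge`;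
written as a telescoping finite sum of smooth fields using the handover `ρ_n(1) = ρ_{n+1}(0)`). [cite: Cheskidov2023, §3 (3.5)] -/
def profile (ρ : ℕ → ℝ → UnitAddTorus d → ℝ) (m : ℕ) (t : ℝ) (x : UnitAddTorus d) : ℝ :=
  ρ 0 0 x + ∑ n ∈ Finset.range (m + 1), (blockProfile ρ n t x - ρ n 0 x)

/-- **Building blocks for the gluing**: smooth solutions `ρ_n` of the transport equation with
smooth divergence-free drifts `v_n` on `[0,1] × T^d`, handed over continuously,
`ρ_n(1) = ρ_{n+1}(0)` (Cheskidov 2023, Thm. 3.1; Bruè–De Lellis 2023, Thm. 4.1 (d); the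
hypothesis structure consumed by the gluing lemmas — an instance is provided by
`Literature.Analysis.FluidPDE.alberti_crippa_mazzucato_quasi_self_similar`). [cite: Cheskidov2023, Thm. 3.1] -/
structure Blocks (ρ : ℕ → ℝ → UnitAddTorus d → ℝ) (v : ℕ → ℝ → UnitAddTorus d → EuclideanSpace ℝ d) :
    Prop where
  /-- Each block is a classical transport solution on `[0,1]` with divergence-free drift. -/
  sol : ∀ n, Torus.IsClassicalScalarTransportOn (Icc 0 1) 0 (v n) (ρ n)
  /-- Continuous handover of the scalar between consecutive blocks. -/
  handover : ∀ n, ρ n 1 = ρ (n + 1) 0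

section Family

variable {v : ℕ → ℝ → UnitAddTorus d → EuclideanSpace ℝ d} {ρ : ℕ → ℝ → UnitAddTorus d → ℝ}
  {m : ℕ} {t : ℝ}

omit [Fintype d] [DecidableEq d] in
/-- In the `j`-th gluing interval only block `j` moves: `v^m(t) = blockDrift v j (t)` for
`t ∈ [t_j, t_{j+1})`, `j ≤ m`. [cite: Cheskidov2023, §3 (3.4)] -/
theorem drift_eq_blockDrift (v : ℕ → ℝ → UnitAddTorus d → EuclideanSpace ℝ d) {j : ℕ} (hj : j ≤ m)
    (ht : t ∈ Ico (tn j) (tn (j + 1))) : drift v m t = blockDrift v j t := by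
  funext x
  rw [drift, Finset.sum_eq_single j]
  · intro n hn hnj
    rw [blockDrift_eq_zero_of_not_mem v]
    · rfl
    rintro ⟨h1, h2⟩
    rcases lt_or_gt_of_ne hnj with h | h
    · have : tn (n + 1) ≤ tn j := tn_mono (Nat.succ_le_of_lt h)
      linarith [ht.1]
    · have : tn (j + 1) ≤ tn n := tn_mono (Nat.succ_le_of_lt h)
      linarith [ht.2]
  · intro h
    exact absurd (Finset.mem_range.2 (Nat.lt_succ_of_le hj)) h

omit [Fintype d] [DecidableEq d] in
/-- `v^m(t) = 0` for `t ≤ 0` (all blocks are at rest before `t_0 = 0`). [cite: Cheskidov2023, §4] -/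
theorem drift_eq_zero_of_nonpos (v : ℕ → ℝ → UnitAddTorus d → EuclideanSpace ℝ d) (ht : t ≤ 0) :
    drift v m t = 0 := by
  funext x
  rw [drift]
  simp only [Pi.zero_apply]
  refine Finset.sum_eq_zero fun n _ => ?_
  rw [blockDrift_eq_zero_of_le v (ht.trans (tn_nonneg n))]
  rfl

omit [Fintype d] [DecidableEq d] in
/-- `v^m(t) = 0` for `t ≥ t_{m+1}` (in particular on `[1, ∞)`; Cheskidov 2023, §4:
"`v^m ≡ 0` on `[t_{m+1}, 2]`"). [cite: Cheskidov2023, §4] -/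
theorem drift_eq_zero_of_ge (v : ℕ → ℝ → UnitAddTorus d → EuclideanSpace ℝ d) (ht : tn (m + 1) ≤ t) :
    drift v m t = 0 := by
  funext x
  rw [drift]
  simp only [Pi.zero_apply]
  refine Finset.sum_eq_zero fun n hn => ?_
  have hn' : n + 1 ≤ m + 1 := Nat.succ_le_of_lt (Finset.mem_range.1 hn)
  rw [blockDrift_eq_zero_of_ge v ((tn_mono hn').trans ht)]
  rfl

omit [Fintype d] [DecidableEq d] in
/-- `v^m(t) = 0` for `t ≥ 1`. [cite: Cheskidov2023, §4] -/
theorem drift_eq_zero_of_one_le (v : ℕ → ℝ → UnitAddTorus d → EuclideanSpace ℝ d) (ht : 1 ≤ t) :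
    drift v m t = 0 :=
  drift_eq_zero_of_ge v ((tn_lt_one (m + 1)).le.trans ht)

omit [Fintype d] [DecidableEq d] in
/-- `v^m` vanishes off the open interval `(0, 1)`. [cite: Cheskidov2023, §4] -/
theorem drift_eq_zero_of_not_mem (v : ℕ → ℝ → UnitAddTorus d → EuclideanSpace ℝ d)
    (ht : t ∉ Ioo (0 : ℝ) 1) : drift v m t = 0 := by
  rw [mem_Ioo, not_and_or, not_lt, not_lt] at ht
  rcases ht with ht | ht
  · exact drift_eq_zero_of_nonpos v ht
  · exact drift_eq_zero_of_one_le v ht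

omit [Fintype d] [DecidableEq d] in
/-- **Eventual stationarity of the drifts**: for `t ≤ t_{m₁+1}` and `m ≥ m₁`,
`v^m(t) = v^{m₁}(t)` (the added blocks are at rest there; Cheskidov 2023, (3.4): the stages
`n ≤ m₁` are not modified when `m` grows). [cite: Cheskidov2023, §3 (3.4)] -/
theorem drift_eq_drift_of_le {m₁ : ℕ} (v : ℕ → ℝ → UnitAddTorus d → EuclideanSpace ℝ d) (hm : m₁ ≤ m)
    (ht : t ≤ tn (m₁ + 1)) : drift v m t = drift v m₁ t := by
  funext x
  rw [drift, drift, ← Finset.sum_range_add_sum_Ico _ (Nat.succ_le_succ hm)]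
  simp only [add_eq_left]
  refine Finset.sum_eq_zero fun n hn => ?_
  have hn' : m₁ + 1 ≤ n := (Finset.mem_Ico.1 hn).1
  rw [blockDrift_eq_zero_of_le v (ht.trans (tn_mono hn'))]
  rfl

/-- **The glued profile in the `j`-th gluing interval is block `j`**: for `t ∈ [t_j, t_{j+1}]`,
`j ≤ m`, `ρ^m(t) = ρ_j(σ_j(t))` (earlier blocks are frozen at `ρ_n(1) = ρ_{n+1}(0)` and telescope,
later ones contribute `0`; Cheskidov 2023, (3.5)). [cite: Cheskidov2023, §3 (3.5)] -/
theorem profile_eq_blockProfile (hB : Blocks ρ v) {j : ℕ} (hj : j ≤ m) (ht : t ∈ Icc (tn j) (tn (j + 1))) :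
    profile ρ m t = blockProfile ρ j t := by
  funext x
  rw [profile, ← Finset.sum_range_add_sum_Ico _ (Nat.succ_le_succ hj), Finset.sum_range_succ]
  have h1 : ∑ n ∈ Finset.range j, (blockProfile ρ n t x - ρ n 0 x) = ρ j 0 x - ρ 0 0 x := by
    have : ∀ n ∈ Finset.range j, blockProfile ρ n t x - ρ n 0 x = ρ (n + 1) 0 x - ρ n 0 x := by
      intro n hn
      have hn' : n + 1 ≤ j := Nat.succ_le_of_lt (Finset.mem_range.1 hn)
      rw [blockProfile_eq_of_ge ρ ((tn_mono hn').trans ht.1), hB.handover n]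
    rw [Finset.sum_congr rfl this]
    exact Finset.sum_range_sub (fun n => ρ n 0 x) j
  have h2 : ∑ n ∈ Finset.Ico (j + 1) (m + 1), (blockProfile ρ n t x - ρ n 0 x) = 0 := by
    refine Finset.sum_eq_zero fun n hn => ?_
    have hn' : j + 1 ≤ n := (Finset.mem_Ico.1 hn).1
    rw [blockProfile_eq_of_le ρ (ht.2.trans (tn_mono hn')), sub_self]
  rw [h1, h2]
  ring

/-- After `t_{m+1}` the glued profile is frozen at `ρ_m(1)` (Cheskidov 2023, §4:
`ρ^m(t) = ρ^m(1)` on `[1,2]`, indeed from `t_{m+1}` on, where `v^m ≡ 0`). [cite: Cheskidov2023, §4] -/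
theorem profile_eq_of_ge (hB : Blocks ρ v) (ht : tn (m + 1) ≤ t) : profile ρ m t = ρ m 1 := by
  funext x
  rw [profile]
  have : ∀ n ∈ Finset.range (m + 1), blockProfile ρ n t x - ρ n 0 x = ρ (n + 1) 0 x - ρ n 0 x := by
    intro n hn
    have hn' : n + 1 ≤ m + 1 := Nat.succ_le_of_lt (Finset.mem_range.1 hn)
    rw [blockProfile_eq_of_ge ρ ((tn_mono hn').trans ht), hB.handover n]
  rw [Finset.sum_congr rfl this, Finset.sum_range_sub (fun n => ρ n 0 x) (m + 1), ← hB.handover m]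
  ring

omit [Fintype d] [DecidableEq d] in
/-- Before `t_0 = 0` the glued profile is frozen at the datum `ρ_0(0)`. [folklore] -/
theorem profile_eq_of_nonpos (ρ : ℕ → ℝ → UnitAddTorus d → ℝ) (ht : t ≤ 0) : profile ρ m t = ρ 0 0 := by
  funext x
  rw [profile, add_eq_left]
  refine Finset.sum_eq_zero fun n _ => ?_
  rw [blockProfile_eq_of_le ρ (ht.trans (tn_nonneg n)), sub_self]

omit [Fintype d] [DecidableEq d] in
/-- The glued profiles all start from the datum `ρ_0(0)` (Cheskidov 2023, (3.2): `ρ̃^m(0) = ρ_in`). [cite: Cheskidov2023, §3 (3.2)] -/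
theorem profile_zero (ρ : ℕ → ℝ → UnitAddTorus d → ℝ) : profile ρ m 0 = ρ 0 0 :=
  profile_eq_of_nonpos ρ le_rfl

omit [Fintype d] [DecidableEq d] in
/-- **Eventual stationarity of the profiles**: for `t ≤ t_{m₁+1}` and `m ≥ m₁`,
`ρ^m(t) = ρ^{m₁}(t)` (Cheskidov 2023, §6: "`ρ^m = ρ̃` on `[0,T]` for all large `m`"). [cite: Cheskidov2023, §3 (3.5)] -/
theorem profile_eq_profile_of_le {m₁ : ℕ} (ρ : ℕ → ℝ → UnitAddTorus d → ℝ) (hm : m₁ ≤ m)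
    (ht : t ≤ tn (m₁ + 1)) : profile ρ m t = profile ρ m₁ t := by
  funext x
  rw [profile, profile, ← Finset.sum_range_add_sum_Ico _ (Nat.succ_le_succ hm)]
  simp only [add_right_inj, add_eq_left]
  refine Finset.sum_eq_zero fun n hn => ?_
  have hn' : m₁ + 1 ≤ n := (Finset.mem_Ico.1 hn).1
  rw [blockProfile_eq_of_le ρ (ht.trans (tn_mono hn')), sub_self]

/-- The glued drift is smooth on all of `ℝ × T^d` (a finite sum of smooth fields; Cheskidov 2023,
§4: `v^m ∈ C^∞([0,2] × T²)`, here on `ℝ`). [cite: Cheskidov2023, §4] -/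
theorem isSmoothSpaceTimeOn_drift (hB : Blocks ρ v) (m : ℕ) :
    FunctionSpaces.Torus.IsSmoothSpaceTimeOn univ (drift v m) :=
  FunctionSpaces.Torus.IsSmoothSpaceTimeOn.sum fun n _ => isSmoothSpaceTimeOn_blockDrift (hB.sol n).smooth_velocity

/-- The glued profile is smooth on all of `ℝ × T^d` (Cheskidov 2023, §4: `ρ^m ∈ C^∞([0,2] × T²)`,
here on `ℝ`). [cite: Cheskidov2023, §4] -/
theorem isSmoothSpaceTimeOn_profile (hB : Blocks ρ v) (m : ℕ) :
    FunctionSpaces.Torus.IsSmoothSpaceTimeOn univ (profile ρ m) := by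
  have h0 : FunctionSpaces.Torus.IsSmooth (ρ 0 0) :=
    (hB.sol 0).smooth_scalar.isSmooth_slice ⟨le_rfl, zero_le_one⟩
  have hc : FunctionSpaces.Torus.IsSmoothSpaceTimeOn univ (fun (_ : ℝ) => ρ 0 0) :=
    FunctionSpaces.Torus.isSmoothSpaceTimeOn_const h0 _
  refine hc.add (FunctionSpaces.Torus.IsSmoothSpaceTimeOn.sum fun n _ => ?_)
  exact (isSmoothSpaceTimeOn_blockProfile (hB.sol n).smooth_scalar).sub
    (FunctionSpaces.Torus.isSmoothSpaceTimeOn_const ((hB.sol n).smooth_scalar.isSmooth_slice ⟨le_rfl, zero_le_one⟩) _)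

/-- Finite sums of `C¹` divergence-free fields are divergence free. [folklore] -/
theorem _root_.Literature.Analysis.FunctionSpaces.Torus.isDivFree_finset_sum {ι : Type*} (s : Finset ι)
    {f : ι → UnitAddTorus d → EuclideanSpace ℝ d} (hf : ∀ i ∈ s, FunctionSpaces.Torus.IsContDiff 1 (f i))
    (hdiv : ∀ i ∈ s, FunctionSpaces.Torus.IsDivFree (f i)) :
    FunctionSpaces.Torus.IsDivFree (fun x => ∑ i ∈ s, f i x) := by
  intro x
  rw [FunctionSpaces.Torus.divergence]
  have : ∀ j : d, FunctionSpaces.Torus.partialDeriv j (fun y => (∑ i ∈ s, f i y) j) x =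
      ∑ i ∈ s, FunctionSpaces.Torus.partialDeriv j (fun y => f i y j) x := by
    intro j
    have heq : (fun y => (∑ i ∈ s, f i y) j) = fun y => ∑ i ∈ s, f i y j := by
      funext y; simp [Finset.sum_apply]
    rw [heq]
    refine FunctionSpaces.Torus.partialDeriv_finset_sum s (fun i hi => ?_) j x
    exact ((EuclideanSpace.proj (𝕜 := ℝ) j).contDiff.comp (hf i hi) :
      FunctionSpaces.Torus.IsContDiff 1 (fun y => f i y j))
  simp_rw [this]
  rw [Finset.sum_comm]
  exact Finset.sum_eq_zero fun i hi => hdiv i hi x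

/-- The glued drift is divergence free at every time. [cite: Cheskidov2023, §3 (3.4)] -/
theorem isDivFree_drift (hB : Blocks ρ v) (m : ℕ) (t : ℝ) : FunctionSpaces.Torus.IsDivFree (drift v m t) :=
  FunctionSpaces.Torus.isDivFree_finset_sum _
    (fun n _ => (isSmooth_blockDrift (hB.sol n).smooth_velocity t).isContDiff (by simp))
    (fun n _ => isDivFree_blockDrift (hB.sol n) t)

/-- The glued drift has zero mean at every time as soon as every block drift slice has
(Cheskidov 2023 / Bruè–De Lellis 2023, Thm. 4.1 (c): compact support in the open square). [folklore] -/
theorem hasZeroMean_drift (hB : Blocks ρ v) (hmean : ∀ n, ∀ s ∈ Icc (0 : ℝ) 1, FunctionSpaces.Torus.HasZeroMean (v n s))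
    (m : ℕ) (t : ℝ) : FunctionSpaces.Torus.HasZeroMean (drift v m t) := by
  unfold FunctionSpaces.Torus.HasZeroMean
  have hint : ∀ n ∈ Finset.range (m + 1), Integrable (blockDrift v n t) volume :=
    fun n _ => (isSmooth_blockDrift (hB.sol n).smooth_velocity t).integrable
  rw [show (fun x => drift v m t x) = fun x => ∑ n ∈ Finset.range (m + 1), blockDrift v n t x from rfl,
    integral_finsetSum _ hint]
  refine Finset.sum_eq_zero fun n _ => ?_
  have h := hmean n (sigma n t) (sigma_mem_Icc n t)
  unfold FunctionSpaces.Torus.HasZeroMean at h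
  simp only [blockDrift, integral_smul, h, smul_zero]

/-- **The transport identity for the glued family on all of `ℝ`**:
`∂ₜρ^m(t,x) + ⟪v^m(t,x), ∇ρ^m(t)(x)⟫ = 0` for every `t ∈ ℝ` (in a gluing interval
`[t_j, t_{j+1})`, `j ≤ m`, only block `j` moves and `ρ^m(t) = ρ_j(σ_j(t))`; elsewhere nothing
moves; Cheskidov 2023, (3.9) for the truncated families of (3.4)–(3.5)). [cite: Cheskidov2023, §3 (3.9)] -/
theorem deriv_profile_add_inner (hB : Blocks ρ v) (m : ℕ) (t : ℝ) (x : UnitAddTorus d) :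
    deriv (fun s => profile ρ m s x) t +
      ⟪drift v m t x, FunctionSpaces.Torus.gradient (profile ρ m t) x⟫_ℝ = 0 := by
  -- the time derivative of the profile, block by block
  have hder : HasDerivAt (fun s => profile ρ m s x)
      (∑ n ∈ Finset.range (m + 1), deriv (fun s => blockProfile ρ n s x) t) t := by
    have h1 : HasDerivAt (fun s => ∑ n ∈ Finset.range (m + 1), (blockProfile ρ n s x - ρ n 0 x))
        (∑ n ∈ Finset.range (m + 1), deriv (fun s => blockProfile ρ n s x) t) t := by
      refine HasDerivAt.fun_sum fun n _ => ?_
      simpa using ((hasDerivAt_blockProfile (hB.sol n).smooth_scalar t x).differentiableAt.hasDerivAt).sub_const (ρ n 0 x)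
    simpa [profile] using h1.const_add (ρ 0 0 x)
  rw [hder.deriv]
  have hblock : ∀ n, deriv (fun s => blockProfile ρ n s x) t =
      -⟪blockDrift v n t x, FunctionSpaces.Torus.gradient (blockProfile ρ n t) x⟫_ℝ := fun n => by
    linarith [deriv_blockProfile_add_inner (hB.sol n) t x]
  simp_rw [hblock]
  -- case analysis on the position of `t`
  by_cases hpos : 0 ≤ t ∧ t < tn (m + 1)
  · obtain ⟨h0, htm⟩ := hpos
    have ht1 : t < 1 := htm.trans (tn_lt_one _)
    set j := blockIdx t with hj
    have hmem : t ∈ Ico (tn j) (tn (j + 1)) := mem_Ico_tn_blockIdx h0 ht1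
    have hjm : j ≤ m := by
      by_contra hlt
      push Not at hlt
      have : tn (m + 1) ≤ tn j := tn_mono (Nat.succ_le_of_lt hlt)
      linarith [hmem.1]
    rw [drift_eq_blockDrift v hjm hmem, profile_eq_blockProfile hB hjm (Ico_subset_Icc_self hmem),
      Finset.sum_eq_single j]
    · ring
    · intro n _ hnj
      rw [blockDrift_eq_zero_of_not_mem v]
      · simp
      rintro ⟨h1, h2⟩
      rcases lt_or_gt_of_ne hnj with h | h
      · have : tn (n + 1) ≤ tn j := tn_mono (Nat.succ_le_of_lt h)
        linarith [hmem.1]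
      · have : tn (j + 1) ≤ tn n := tn_mono (Nat.succ_le_of_lt h)
        linarith [hmem.2]
    · intro h
      exact absurd (Finset.mem_range.2 (Nat.lt_succ_of_le hjm)) h
  · -- no block moves at time `t`
    have hzero : ∀ n ∈ Finset.range (m + 1), blockDrift v n t = 0 := by
      intro n hn
      rw [not_and_or, not_le, not_lt] at hpos
      rcases hpos with h | h
      · exact blockDrift_eq_zero_of_le v (h.le.trans (tn_nonneg n))
      · exact blockDrift_eq_zero_of_ge v ((tn_mono (Nat.succ_le_of_lt (Finset.mem_range.1 hn))).trans h)
    have hdrift : drift v m t = 0 := by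
      funext y
      rw [drift]
      simp only [Pi.zero_apply]
      exact Finset.sum_eq_zero fun n hn => by rw [hzero n hn]; rfl
    rw [hdrift, Finset.sum_eq_zero fun n hn => by rw [hzero n hn]; simp]
    simp

/-- **The glued pair is a classical transport solution** on every time set of unique
differentiability (e.g. `[0, 2]`): `∂ₜρ^m + v^m·∇ρ^m = 0`, `div v^m = 0`, with `v^m`, `ρ^m` jointly
smooth (Cheskidov 2023, §4: "`ρ^m(t)` satisfies the transport equation with drift `v^m(t)` on
the extended time interval `[0,2]`"). [cite: Cheskidov2023, §4] -/
theorem isClassicalScalarTransportOn_profile (hB : Blocks ρ v) (m : ℕ) {S : Set ℝ}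
    (hS : UniqueDiffOn ℝ S) : Torus.IsClassicalScalarTransportOn S 0 (drift v m) (profile ρ m) where
  smooth_velocity := (isSmoothSpaceTimeOn_drift hB m).mono (subset_univ _)
  smooth_scalar := (isSmoothSpaceTimeOn_profile hB m).mono (subset_univ _)
  transport t ht x := by
    have hd := ((isSmoothSpaceTimeOn_profile hB m).hasDerivWithinAt_slice (mem_univ t) x).hasDerivAt univ_mem
    rw [FunctionSpaces.Torus.timeDerivWithin, hd.hasDerivWithinAt.derivWithin (hS t ht), zero_mul]
    have h := deriv_profile_add_inner hB m t x
    rwa [hd.deriv] at h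
  divFree t _ := isDivFree_drift hB m t

/-! ## The limit profile `ρ̃` (Cheskidov 2023, (3.8)) -/

/-- **Cheskidov's inviscid limit profile** `ρ̃(t) = ρ_{n}(σ_n(t))` for `t` in the `n`-th gluing
interval (arXiv:2311.04182, (3.8); meaningful for `t < 1`, junk (`= ρ_{blockIdx t}(σ(t))`) for
`t ≥ 1`). It agrees with every `ρ^m` on `(-∞, t_{m+1})` (`limProfile_eq_profile`). [cite: Cheskidov2023, §3 (3.8)] -/
def limProfile (ρ : ℕ → ℝ → UnitAddTorus d → ℝ) (t : ℝ) (x : UnitAddTorus d) : ℝ :=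
  blockProfile ρ (blockIdx t) t x

omit [Fintype d] [DecidableEq d] in
/-- For `t < 0` the block index is `0`. [folklore] -/
theorem blockIdx_of_neg (ht : t < 0) : blockIdx t = 0 := by
  unfold blockIdx
  have h1 : 1 / (1 - t) < 1 := by rw [div_lt_one (by linarith)]; linarith
  rw [Nat.floor_eq_zero.2 h1]

/-- **`ρ̃ = ρ^m` before `t_{m+1}`** (Cheskidov 2023, §6: "`ρ^m χ_{[…]} = ρ̃ χ_{[…]}` for all large
`m`"; here for all `t < t_{m+1}`). [cite: Cheskidov2023, §3 (3.8)] -/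
theorem limProfile_eq_profile (hB : Blocks ρ v) (ht : t < tn (m + 1)) : limProfile ρ t = profile ρ m t := by
  funext x
  rw [limProfile]
  by_cases h0 : 0 ≤ t
  · have ht1 : t < 1 := ht.trans (tn_lt_one _)
    have hmem : t ∈ Ico (tn (blockIdx t)) (tn (blockIdx t + 1)) := mem_Ico_tn_blockIdx h0 ht1
    have hjm : blockIdx t ≤ m := by
      by_contra hlt
      push Not at hlt
      have : tn (m + 1) ≤ tn (blockIdx t) := tn_mono (Nat.succ_le_of_lt hlt)
      linarith [hmem.1]
    rw [profile_eq_blockProfile hB hjm (Ico_subset_Icc_self hmem)]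
  · push Not at h0
    rw [blockIdx_of_neg h0, blockProfile_eq_of_le ρ (h0.le.trans (tn_nonneg 0)), profile_eq_of_nonpos ρ h0.le]

/-- **`ρ̃` is smooth on `(-∞, 1) × T^d`** (locally it is one of the smooth `ρ^m`; Cheskidov 2023,
p. 10: `ρ̃ ∈ C^∞([0,1) × T²)`). [cite: Cheskidov2023, §3 (3.8)] -/
theorem isSmoothSpaceTimeOn_limProfile (hB : Blocks ρ v) :
    FunctionSpaces.Torus.IsSmoothSpaceTimeOn (Iio 1) (limProfile ρ) := by
  refine contDiffOn_of_locally_contDiffOn fun p hp => ?_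
  obtain ⟨t, y⟩ := p
  have ht : t < 1 := (mem_prod.1 hp).1
  -- choose `m` with `t < t_{m+1}`
  obtain ⟨m, hm⟩ : ∃ m : ℕ, t < tn (m + 1) := by
    have h := (tendsto_tn.comp (tendsto_add_atTop_nat 1)).eventually (Ioi_mem_nhds ht)
    exact h.exists
  refine ⟨Iio (tn (m + 1)) ×ˢ univ, isOpen_Iio.prod isOpen_univ, mk_mem_prod hm (mem_univ _), ?_⟩
  have hsub : Iio (1 : ℝ) ×ˢ (univ : Set (EuclideanSpace ℝ d)) ∩ Iio (tn (m + 1)) ×ˢ univ ⊆ Iio (tn (m + 1)) ×ˢ univ :=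
    inter_subset_right
  have hprof : ContDiffOn ℝ ∞ (FunctionSpaces.Torus.stLift (profile ρ m))
      (Iio (1 : ℝ) ×ˢ (univ : Set (EuclideanSpace ℝ d)) ∩ Iio (tn (m + 1)) ×ˢ univ) :=
    ContDiffOn.mono (isSmoothSpaceTimeOn_profile hB m) fun q _ => mk_mem_prod (mem_univ _) (mem_univ _)
  refine hprof.congr fun q hq => ?_
  obtain ⟨s, z⟩ := q
  have hs : s < tn (m + 1) := (mem_prod.1 (hsub hq)).1
  simp only [FunctionSpaces.Torus.stLift_apply]
  rw [limProfile_eq_profile hB hs]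

/-- `ρ̃(0) = ρ_0(0)`, the common datum (Cheskidov 2023, (3.2), (3.9)). [cite: Cheskidov2023, §3 (3.2)] -/
theorem limProfile_zero (hB : Blocks ρ v) : limProfile ρ 0 = ρ 0 0 := by
  rw [limProfile_eq_profile hB (m := 0) (by rw [tn_succ, tn_zero, zero_add]; exact tau_pos 0), profile_zero]

end Family

end Literature.Analysis.FluidPDE.Gluing

end
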